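import Summits.ResolutionOfSingularities.ResolutionOfSingularities.Theorems.PurelyInseparableDim4ResConeCInfFrameToolsPrime
import Summits.ResolutionOfSingularities.ResolutionOfSingularities.Theorems.PurelyInseparableDim4ResConeCInfVirtualEntry
import Summits.ResolutionOfSingularities.ResolutionOfSingularities.Theorems.PurelyInseparableDim4ResConeCInfPinningPrime
import HarnessLib
import HarnessLib.Audit.Tags

/-!
# Purely inseparable four-folds — THE C∞ FRAMED CHILD FOR EVERY PRIME (ENTRY-2 of the power-cone light-pair line):
# at ONE real slot step of the light pair at `(p, p − 1)`, a FRAMED re-presentation `C₁` of the real child — straight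
# `resForm = a·x_f^d`, exact pair ledger, order `d + 2`, `r = x_λ x_μ ∣ F`, isolated, `e_G = 3` — with
# `C₁.F = clean (tsch f Φ A.F)` for an admissible `f`-datum `Φ` (cell `res-dim4-pi`, K2(p) lane, rung-1 POWER-CONE LINE
# «light pair of TAIL(p, p−1, 3) ∀ p»; the `(5,4)` instance is steps (0)–(4) of res-dim4-p-3 g4's
# `ResCone.exists_cInf_virtual_entry`, `…ResConeCInfVirtualEntry` p702047)

[OURS · counted 0 · cell `res-dim4-pi` · K2(p) lane (holder res-dim4-p-12 g5, line booked g5-2 (6), ENTRY confirmed to this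
lineage 2026-08-29 10:45Z); seat res-dim4-p-3 g5.]  Nothing here proves K2(p) for any `p`, any TAIL(p, p−1, 3), any
TAIL(7, d, e), `NoIsolatedTrap p p`, the Cossart–Jannsen–Saito theorem or resolution of singularities in dimension ≥ 4 /
characteristic `p` — NOT proved.  AI kernel work, weaker than expert review.  This file is ENTRY bookkeeping: it kills nothing.

**`exists_cInf_framed_child_prime`** (`d + 1 = p`, `2 ≤ d`).  INPUT (two real states, no chain): a real SLOT step
`A = step p univ κ β A′`, `κ ∈ {λ, μ}`, `β` vanishing on `κ, λ, μ`, both states of order `d + 2` with ledger `r = x_λ x_μ ∣ F`,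
`A′` clean with a POWER CONE `resForm A′ = a₀·ℓ^d` charging the free letter `f` (`ℓ_f ≠ 0`) and the EXACT PAIR LEDGER in
ideal form `U·G′ = S·x_λx_μ + T·ℓ^d`, `U(0) ≠ 0` (K11-lin `stretch_pair_ledger_linear`, `{p}`-generic), `A` isolated with
`e_G = 3`.  OUTPUT: states `S₂, C₁` and an `f`-datum `Φ` (`f ∉ vars Φ`, `Φ(0) = 0`) with `C₁ = step p univ κ 0 S₂` (a PURE
CORNER slot step from the doubly re-framed parent `S₂`: `r = x_λx_μ ∣ F`, order `d + 2`, `resForm S₂ = (a₀ ℓ_f^d)·x_f^d`,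
exact ledger — the context in which res-dim4-typ-1 g3's `cInf_uFlag_of_child` reads the u-flag at `p = 5`),
`C₁.F = clean (tsch f Φ A.F)`, order `d + 2`, `C₁.r = x_λ x_μ ∣ C₁.F`, `resForm C₁ = (a₀ ℓ_f^d)·x_f^d` (`a₀ ℓ_f^d ≠ 0`),
the exact pair-ledger support form («`e_f ≤ d − 1 ⇒ 2 ≤ e_λ ∧ 2 ≤ e_μ`»), `IsIsolated p C₁.F`, `e_G(C₁) = 3`.
ROUTE (verbatim the `p = 5` one, numerals `5 ↦ p`, `6 ↦ d + 2`, `x_f⁴ ↦ x_f^d`, `5 ∤ 6 ↦ p ∤ d + 2 = p + 1`): straighten the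
parent at `f` (`φ_ℓ`, res-dim4-p-11's `resForm_cleanTschState_straighten`), kill the `u`-translation by the linear datum
`(β u)·x_κ` (`step_cleanTsch`: clean re-framing commutes with the point step), read that the step from the doubly re-framed
parent `S₂` is PURE CORNER by res-dim4-typ-1 g5's state-level (VT-f) `cInf_translation_contact_eq_zero_of_le_prime`, and
carry straightness + exact ledger through the corner step by ENTRY-1 `cInf_entry_of_corner_prime`; isolation and `e_G` of
`C₁` are those of `A` (`isIsolated_clean_tsch_iff`, `finrank_resVertex_cleanTschState` with `p ∤ d + 2`), the ledger of
`S₂` is `lowLedger_frame_of_pair_ledger_linear`.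
WHAT IS NOT HERE (honest): the `u`-FLAG / dead-row conjuncts and the second Tschirnhaus `ψ` of the `(5,4)` entry (steps
(5)–(6)) — at `d ≥ 6` the flag `∃ c′ ≤ d − 2, coeff_{r + λ + μ + (d−1−c′)u + c′f} ≠ 0` is NOT a consequence of isolation
(Q-FLAG, bus 2026-08-29 10:47Z, OPEN); ENTRY-3 packages `C₁ ↦ B₀` GIVEN a flag, with res-dim4-typ-1's c′-general second
Tschirnhaus.  [cite: CossartJannsenSaito2020, Thm. 3.14, Lemma 13.2] [cite: Hauser2010, §§F–G] [cite: Kollar2007, Aside 3.57]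
bears_on: LADDER-RESOLUTION:D157-DOOR2 (res-dim4-pi · K2(p) · power cones · C∞ entry every prime, framed child).  Supports
stmt-ResolutionOfSingularities-16155 (helper).
-/

set_option linter.dupNamespace false -- mandated namespace of this single-conjunct summit

noncomputable section

namespace Summit.ResolutionOfSingularities.ResolutionOfSingularities.Theorems.PIDim4

namespace ResCone

open MvPolynomial Finset FrameChange
open Literature.AlgebraicGeometry.Resolution
open Literature.AlgebraicGeometry.Resolution.CentreBlowup
open Literature.AlgebraicGeometry.Resolution.Hauser2010
open Literature.AlgebraicGeometry.Resolution.HauserPerlega2019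
open PointBlowup (translate)

variable {K : Type} [Field K] [DecidableEq K]

/-- `p ∤ p + 1` for a prime `p`, in the form `p ∤ d + 2` with `d + 1 = p`. [folklore] -/
theorem not_dvd_add_two_of_succ_eq {p d : ℕ} (hp : p.Prime) (hdp : d + 1 = p) : ¬ p ∣ d + 2 := by
  intro h
  rw [show d + 2 = p + 1 by omega] at h
  exact hp.one_lt.ne' (Nat.dvd_one.mp ((Nat.dvd_add_right (dvd_refl p)).mp h))

/-- **THE C∞ FRAMED CHILD, every prime** (statement and route in the module docstring). [OURS]
[cite: CossartJannsenSaito2020, Thm. 3.14, Lemma 13.2] -/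
theorem exists_cInf_framed_child_prime (p : ℕ) [hp : Fact p.Prime] [CharP K p] {d : ℕ} (hdp : d + 1 = p) (hd2 : 2 ≤ d)
    {la mu u f : Fin 4} (hlm : la ≠ mu) (hlu : la ≠ u) (hlf : la ≠ f) (hmu : mu ≠ u) (hmf : mu ≠ f) (huf : u ≠ f)
    {κ : Fin 4} (hκ : κ = la ∨ κ = mu) {A' A : State K} {β : Fin 4 → K}
    (hβκ : β κ = 0) (hβla : β la = 0) (hβmu : β mu = 0) (hA : A = CentreBlowup.step p Finset.univ κ β A')
    (hrA' : A'.r = Finsupp.single la 1 + Finsupp.single mu 1) (hrA : A.r = Finsupp.single la 1 + Finsupp.single mu 1)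
    (hdivA' : ∀ e ∈ A'.F.support, A'.r ≤ e) (hdivA : ∀ e ∈ A.F.support, A.r ≤ e)
    (hoA' : ordZero A'.F = ((d + 2 : ℕ) : ℕ∞)) (hoA : ordZero A.F = ((d + 2 : ℕ) : ℕ∞))
    (hcleanA' : deletePthPowers p A'.F = A'.F) (hisoA : IsIsolated p A.F)
    (he3A : Module.finrank K (resVertex A) = 3) {ℓ : Fin 4 → K} {a0 : K}
    (hform' : resForm A' = C a0 * (∑ i, C (ℓ i) * X i) ^ d) (hℓf : ℓ f ≠ 0) {U S T : MvPolynomial (Fin 4) K}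
    (hU : MvPolynomial.eval (0 : Fin 4 → K) U ≠ 0)
    (hledger : U * (A'.F.divMonomial A'.r) = S * (X la * X mu) + T * (∑ i, C (ℓ i) * X i) ^ d) :
    ∃ (S₂ C₁ : State K) (Φ : MvPolynomial (Fin 4) K),
      -- the doubly re-framed parent `S₂` and the PURE CORNER step to the framed child
      C₁ = CentreBlowup.step p Finset.univ κ 0 S₂ ∧
      S₂.r = Finsupp.single la 1 + Finsupp.single mu 1 ∧ (∀ e ∈ S₂.F.support, S₂.r ≤ e) ∧
      ordZero S₂.F = ((d + 2 : ℕ) : ℕ∞) ∧ resForm S₂ = C (a0 * ℓ f ^ d) * X f ^ d ∧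
      (∀ e ∈ S₂.F.support, e f ≤ d - 1 → 2 ≤ e la ∧ 2 ≤ e mu) ∧
      -- the framed child `C₁` re-presents the real child `A`
      f ∉ Φ.vars ∧ constantCoeff Φ = 0 ∧ C₁.F = deletePthPowers p (tsch f Φ A.F) ∧
      ordZero C₁.F = ((d + 2 : ℕ) : ℕ∞) ∧ C₁.r = Finsupp.single la 1 + Finsupp.single mu 1 ∧
      (∀ e ∈ C₁.F.support, C₁.r ≤ e) ∧
      a0 * ℓ f ^ d ≠ 0 ∧ resForm C₁ = C (a0 * ℓ f ^ d) * X f ^ d ∧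
      (∀ e ∈ C₁.F.support, e f ≤ d - 1 → 2 ≤ e la ∧ 2 ≤ e mu) ∧
      IsIsolated p C₁.F ∧ Module.finrank K (resVertex C₁) = 3 := by
  -- (0) letters and basic facts
  have hκf : κ ≠ f := by rcases hκ with rfl | rfl <;> assumption
  have hκu : κ ≠ u := by rcases hκ with rfl | rfl <;> assumption
  have hrf' : A'.r f = 0 := by
    rw [hrA', Finsupp.add_apply, Finsupp.single_eq_of_ne hlf.symm, Finsupp.single_eq_of_ne hmf.symm, add_zero]
  have hru' : A'.r u = 0 := by
    rw [hrA', Finsupp.add_apply, Finsupp.single_eq_of_ne hlu.symm, Finsupp.single_eq_of_ne hmu.symm, add_zero]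
  have hrfA : A.r f = 0 := by
    rw [hrA, Finsupp.add_apply, Finsupp.single_eq_of_ne hlf.symm, Finsupp.single_eq_of_ne hmf.symm, add_zero]
  have hq' : ((p : ℕ) : ℕ∞) ≤ ordZero A'.F := by rw [hoA']; exact_mod_cast (by omega : p ≤ d + 2)
  have hpd : ¬ p ∣ d + 2 := not_dvd_add_two_of_succ_eq hp.out hdp
  have hAclean : deletePthPowers p A.F = A.F := by rw [hA]; exact deletePthPowers_step_F p Finset.univ κ β A'
  have hA0 : a0 * ℓ f ^ d ≠ 0 := straighten_coeff_ne_zero (ne_zero_of_resForm_eq_C_mul hoA' hdivA' hform') hℓf d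
  -- the exc-free copy of the parent
  set A'ₑ : State K := ⟨A'.F, A'.r, ∅⟩ with hA'ₑ
  have hAₑ : (CentreBlowup.step p Finset.univ κ β A'ₑ).F = A.F ∧ (CentreBlowup.step p Finset.univ κ β A'ₑ).r = A.r := by
    rw [hA]; exact step_F_r_of_exc p κ β A' ∅
  -- (1) the data: straightening at `f`, translation killer at `u`
  obtain ⟨hΦvars, hΦ0, -⟩ := straighten_datum_admissible (K := K) (f := f) ℓ
  set Φ : MvPolynomial (Fin 4) K := ∑ i, C ((fun i => if i = f then (0 : K) else -(ℓ i / ℓ f)) i) * X i with hΦ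
  set Φ' : MvPolynomial (Fin 4) K := chartTransform 1 Finset.univ κ Φ with hΦ'
  set b₁ : Fin 4 → K := Function.update β f (β f - MvPolynomial.eval β Φ') with hb₁
  set Φp : MvPolynomial (Fin 4) K := translate b₁ Φ' - C (MvPolynomial.eval b₁ Φ') with hΦp
  have hΦpvars : f ∉ Φp.vars := not_mem_vars_tschShift (not_mem_vars_chartTransform 1 Finset.univ hκf hΦvars) b₁
  have hΦp0 : constantCoeff Φp = 0 := constantCoeff_tschShift b₁ Φ'
  have hev : MvPolynomial.eval b₁ Φ' = MvPolynomial.eval β Φ' :=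
    eval_update_of_not_mem_vars (not_mem_vars_chartTransform 1 Finset.univ hκf hΦvars) β _
  have hb₁' : Function.update b₁ f (b₁ f + MvPolynomial.eval b₁ Φ') = β := by
    rw [hev, hb₁, Function.update_idem, Function.update_apply, if_pos rfl, sub_add_cancel, Function.update_eq_self]
  -- `S₁` := the straightened parent; its step at `b₁` is the straightened child
  set S₁ : State K := ⟨deletePthPowers p (tsch f Φ A'.F), A'.r, ∅⟩ with hS₁
  have hstep₁ : CentreBlowup.step p Finset.univ κ b₁ S₁ =
      ⟨deletePthPowers p (tsch f Φp A.F), A.r, (CentreBlowup.step p Finset.univ κ β A'ₑ).exc⟩ := by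
    have h := step_cleanTsch p (s := A'ₑ) hq' hcleanA' hκf hΦvars hΦ0 hrf' (Finset.notMem_empty f) b₁
    rw [hb₁'] at h
    rw [hS₁, h, hAₑ.1, hAₑ.2]
  have hS₁clean : deletePthPowers p S₁.F = S₁.F := PointBlowup.deletePthPowers_deletePthPowers p _
  have hoS₁ : ordZero S₁.F = ((d + 2 : ℕ) : ℕ∞) := by
    rw [hS₁]; exact (ordZero_clean_tsch p hΦvars hΦ0 hcleanA').trans hoA'
  have hqS₁ : ((p : ℕ) : ℕ∞) ≤ ordZero S₁.F := by rw [hoS₁]; exact_mod_cast (by omega : p ≤ d + 2)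
  have hdivS₁ : ∀ e ∈ S₁.F.support, S₁.r ≤ e := forall_le_of_mem_support_clean_tsch p hrf' hdivA'
  have hruS₁ : S₁.r u = 0 := hru'
  have hresS₁ : resForm S₁ = C (a0 * ℓ f ^ d) * X f ^ d :=
    resForm_cleanTschState_straighten p hoA' hpd hrf' hdivA' hform' hℓf
  -- (2) the translation killer at `u`
  obtain ⟨hψ₀vars, hψ₀0⟩ := linear_datum_admissible (K := K) hκu (β u)
  have hψ₀hom : (C (β u) * X κ : MvPolynomial (Fin 4) K).IsHomogeneous 1 := isHomogeneous_C_mul_X _ _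
  set b₂ : Fin 4 → K := Function.update b₁ u 0 with hb₂
  have hb₁u : b₁ u = β u := by rw [hb₁, Function.update_of_ne huf]
  have hb₂' : Function.update b₂ u (b₂ u + MvPolynomial.eval b₂ (chartTransform 1 Finset.univ κ (C (β u) * X κ))) = b₁ := by
    rw [eval_chartTransform_one_C_mul_X, hb₂, Function.update_idem, Function.update_apply, if_pos rfl, zero_add, ← hb₁u,
      Function.update_eq_self]
  set S₂ : State K := ⟨deletePthPowers p (tsch u (C (β u) * X κ) S₁.F), S₁.r, S₁.exc⟩ with hS₂
  have hstep₂ : CentreBlowup.step p Finset.univ κ b₂ S₂ =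
      ⟨deletePthPowers p (tsch f Φp A.F), A.r, (CentreBlowup.step p Finset.univ κ b₁ S₁).exc⟩ := by
    have h := step_cleanTsch p (s := S₁) hqS₁ hS₁clean hκu hψ₀vars hψ₀0 hru' (Finset.notMem_empty u) b₂
    rw [hb₂'] at h
    rw [hS₂, h, hstep₁]
    have hshift : translate b₂ (chartTransform 1 Finset.univ κ (C (β u) * X κ : MvPolynomial (Fin 4) K)) -
        C (MvPolynomial.eval b₂ (chartTransform 1 Finset.univ κ (C (β u) * X κ : MvPolynomial (Fin 4) K))) = 0 := by
      rw [chartTransform_C_mul, chartTransform_one_X, if_pos rfl, mul_one]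
      exact tschShift_C b₂ (β u)
    rw [hshift, tsch_zero, AlgHom.id_apply, PointBlowup.deletePthPowers_deletePthPowers]
  have hoS₂ : ordZero S₂.F = ((d + 2 : ℕ) : ℕ∞) := by
    rw [hS₂]; exact (ordZero_clean_tsch p hψ₀vars hψ₀0 hS₁clean).trans hoS₁
  have hdivS₂ : ∀ e ∈ S₂.F.support, S₂.r ≤ e := forall_le_of_mem_support_clean_tsch p hru' hdivS₁
  have hrS₂ : S₂.r = Finsupp.single la 1 + Finsupp.single mu 1 := hrA'
  have hresS₂ : resForm S₂ = C (a0 * ℓ f ^ d) * X f ^ d := by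
    rw [hS₂, resForm_cleanTschState_eq p hψ₀vars hψ₀0 hoS₁ hpd,
      resForm_tschState_of_isHomogeneous_one hψ₀vars hψ₀hom hruS₁ hdivS₁, hresS₁, map_mul, FrameChange.tsch_C, map_pow,
      tsch_X_of_ne _ huf.symm]
  -- (3) the step from `S₂` is a PURE CORNER step ((VT-f), res-dim4-typ-1 g5)
  have hoC : ordZero (CentreBlowup.step p Finset.univ κ b₂ S₂).F = ((d + 2 : ℕ) : ℕ∞) := by
    rw [hstep₂]; exact (ordZero_clean_tsch p hΦpvars hΦp0 hAclean).trans hoA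
  have hb₂0 : b₂ = 0 := by
    have hb₂κ : b₂ κ = 0 := by rw [hb₂, Function.update_of_ne hκu, hb₁, Function.update_of_ne hκf]; exact hβκ
    have hb₂la : b₂ la = 0 := by rw [hb₂, Function.update_of_ne hlu, hb₁, Function.update_of_ne hlf]; exact hβla
    have hb₂mu : b₂ mu = 0 := by rw [hb₂, Function.update_of_ne hmu, hb₁, Function.update_of_ne hmf]; exact hβmu
    have hb₂u : b₂ u = 0 := by rw [hb₂, Function.update_apply, if_pos rfl]
    have hb₂f : b₂ f = 0 := by
      rcases hκ with hκl | hκm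
      · subst hκl
        refine cInf_translation_contact_eq_zero_of_le_prime p hdp (Ne.symm hlm) hlf.symm hmf.symm (s := S₂) hoS₂ hA0
          ?_ hb₂la hb₂mu (by rw [hoC]; exact_mod_cast (by omega : 3 ≤ d + 2))
        rw [← monomial_mul_resForm hdivS₂, hresS₂, hrS₂, X_pow_eq_monomial, C_mul_monomial, mul_one, monomial_mul,
          one_mul]
      · subst hκm
        have hrS₂' : S₂.r = Finsupp.single κ 1 + Finsupp.single la 1 := by rw [hrS₂, add_comm]
        refine cInf_translation_contact_eq_zero_of_le_prime p hdp hlm hmf.symm hlf.symm (s := S₂) hoS₂ hA0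
          ?_ hb₂mu hb₂la (by rw [hoC]; exact_mod_cast (by omega : 3 ≤ d + 2))
        rw [← monomial_mul_resForm hdivS₂, hresS₂, hrS₂', X_pow_eq_monomial, C_mul_monomial, mul_one, monomial_mul,
          one_mul]
    funext i
    rcases letters_exhaust hlm hlu hlf hmu hmf huf i with h | h | h | h <;> rw [h, Pi.zero_apply]
    · exact hb₂la
    · exact hb₂mu
    · exact hb₂u
    · exact hb₂f
  rw [hb₂0] at hstep₂ hoC
  -- (4) the framed child `C₁` and the entry of the pure corner step (ENTRY-1)
  set C₁ : State K := CentreBlowup.step p Finset.univ κ 0 S₂ with hC₁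
  have hC₁F : C₁.F = deletePthPowers p (tsch f Φp A.F) := by rw [hstep₂]
  have hrC₁ : C₁.r = Finsupp.single la 1 + Finsupp.single mu 1 := by rw [hstep₂]; exact hrA
  have hdivC₁ : ∀ e ∈ C₁.F.support, C₁.r ≤ e := by
    rw [hstep₂]; exact forall_le_of_mem_support_clean_tsch p hrfA hdivA
  have hisoC₁ : IsIsolated p C₁.F := by rw [hC₁F]; exact (isIsolated_clean_tsch_iff p hΦpvars hΦp0 _).mpr hisoA
  have he3C₁ : Module.finrank K (resVertex C₁) = 3 := by
    rw [hstep₂]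
    exact (finrank_resVertex_cleanTschState p hΦpvars hΦp0 hrfA hdivA hoA hpd).trans he3A
  have hoC₁ : ordZero C₁.F = ((d + 2 : ℕ) : ℕ∞) := hoC
  have hledS₂ : ∀ e ∈ S₂.F.support, e f ≤ d - 1 → 2 ≤ e la ∧ 2 ≤ e mu := by
    intro e he hef
    have h := lowLedger_frame_of_pair_ledger_linear p hlu.symm hmu.symm huf hlf hmf (C (β u) * X κ) hΦ0
      (tsch_linearForm_straighten hℓf) hrf' (monomial_mul_divMonomial hdivA').symm hU hledger e he (by omega)
    rw [hrA'] at h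
    simp only [Finsupp.add_apply, Finsupp.single_eq_same, Finsupp.single_eq_of_ne hlm,
      Finsupp.single_eq_of_ne (Ne.symm hlm), add_zero, zero_add] at h
    obtain ⟨h1, h2⟩ := h
    exact ⟨by omega, by omega⟩
  have hentry : resForm C₁ = C (a0 * ℓ f ^ d) * X f ^ d ∧
      (∀ e ∈ C₁.F.support, e f ≤ d - 1 → 2 ≤ e la ∧ 2 ≤ e mu) := by
    rcases hκ with hκl | hκm
    · subst hκl
      exact cInf_entry_of_corner_prime hlm hlf hmf p hdp hd2 hrS₂ hdivS₂ hoS₂ hA0 hresS₂ hledS₂ hoC₁ he3C₁ hrC₁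
    · subst hκm
      have hrS₂' : S₂.r = Finsupp.single κ 1 + Finsupp.single la 1 := by rw [hrS₂, add_comm]
      have hrC₁' : C₁.r = Finsupp.single κ 1 + Finsupp.single la 1 := by rw [hrC₁, add_comm]
      obtain ⟨h1, h2⟩ := cInf_entry_of_corner_prime (Ne.symm hlm) hmf hlf p hdp hd2 hrS₂' hdivS₂ hoS₂ hA0 hresS₂
        (fun e he hef => (hledS₂ e he hef).symm) hoC₁ he3C₁ hrC₁'
      exact ⟨h1, fun e he hef => (h2 e he hef).symm⟩
  exact ⟨S₂, C₁, Φp, hC₁, hrS₂, hdivS₂, hoS₂, hresS₂, hledS₂, hΦpvars, hΦp0, hC₁F, hoC₁, hrC₁, hdivC₁, hA0, hentry.1,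
    hentry.2, hisoC₁, he3C₁⟩

end ResCone

end Summit.ResolutionOfSingularities.ResolutionOfSingularities.Theorems.PIDim4

end
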